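import Summits.Ventures.PercRepro.MSTightDefect

/-!
# The set-world coloured Marica–Schönheim statement (Θ) and its one-pair regime theorem

For families `A`, `B`, `C` of subsets of a finite type, the **(Θ)-difference family** is
`thetaD A B C = A \\ A ∪ B \\ B ∪ C \\ C ∪ A ⊼ B ∪ B ⊼ C ∪ C ⊼ A ∪ (A ⊻ B)ᶜ ∪ (B ⊻ C)ᶜ ∪ (C ⊻ A)ᶜ`
(within-type differences, pairwise intersections and complements of pairwise unions). The
statement (Θ) — the set-theoretic core of the cell's three-colour Marica–Schönheim conjecture
(CYCLE-MS′ / MS3) — says `|A| + |B| + |C| ≤ |thetaD A B C|` whenever `A, B, C` and their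
complement families are pairwise disjoint (`ThetaValid`). This file proves it when **some type
has at most one pair** (`theta_card_le_of_some_card_le_one`): by the cyclic symmetry
(`thetaD_rotate`) it suffices to treat `B`; with `F = A ∪ Cᶜ` (the transversal, `|A| + |C|`
members), `thetaD ⊇ F \\ F ∪ N_u` where `N_u` are the required cells of the single pair `u`
(`cells_mem_thetaD`), so a violation would make `F` tight with all required cells among its
differences, and the general mixed-cell lemma `mem_or_compl_mem_of_tight` puts `u` or `uᶜ`
into `F` — against the disjointness. Paper: proofs/MINE1-singlemerge.md §17.6 (the regime
theorem in the set world; its coloured form is `msr3_card_le_of_small_type'`).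
-/

namespace PercRepro.MSTight

open Finset
open scoped FinsetFamily

variable {α : Type*} [DecidableEq α] [Fintype α]

/-- The complement family. -/
def compls (A : Finset (Finset α)) : Finset (Finset α) := A.image fun t => Finset.univ \ t

/-- Membership in the complement family. -/
theorem mem_compls {A : Finset (Finset α)} {t : Finset α} :
    t ∈ compls A ↔ Finset.univ \ t ∈ A := by
  constructor
  · intro h
    obtain ⟨s, hs, rfl⟩ := mem_image.1 h
    rwa [Finset.sdiff_sdiff_eq_self (subset_univ s)]
  · intro h
    exact mem_image.2 ⟨Finset.univ \ t, h, Finset.sdiff_sdiff_eq_self (subset_univ t)⟩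

/-- The complement of a member is in the complement family. -/
theorem compl_mem_compls {A : Finset (Finset α)} {t : Finset α} (h : t ∈ A) :
    Finset.univ \ t ∈ compls A :=
  mem_compls.2 (by rwa [Finset.sdiff_sdiff_eq_self (subset_univ t)])

/-- `|compls A| = |A|`. -/
theorem card_compls (A : Finset (Finset α)) : (compls A).card = A.card :=
  card_image_of_injective _ fun s t h => by
    have := congrArg (fun x => Finset.univ \ x) h
    simpa [Finset.sdiff_sdiff_eq_self (subset_univ s), Finset.sdiff_sdiff_eq_self (subset_univ t)]
      using this

/-- The **(Θ)-difference family** of three families. -/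
def thetaD (A B C : Finset (Finset α)) : Finset (Finset α) :=
  A \\ A ∪ B \\ B ∪ C \\ C ∪ A ⊼ B ∪ B ⊼ C ∪ C ⊼ A ∪
    compls (A ⊻ B) ∪ compls (B ⊻ C) ∪ compls (C ⊻ A)

/-- **Validity of a (Θ)-instance**: the three families and their complement families are
pairwise disjoint. -/
def ThetaValid (A B C : Finset (Finset α)) : Prop :=
  Disjoint A (compls A) ∧ Disjoint B (compls B) ∧ Disjoint C (compls C) ∧
    Disjoint A B ∧ Disjoint B C ∧ Disjoint C A ∧
    Disjoint A (compls B) ∧ Disjoint B (compls C) ∧ Disjoint C (compls A)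

/-- The (Θ)-difference family is invariant under the cyclic rotation of the three families. -/
theorem thetaD_rotate (A B C : Finset (Finset α)) : thetaD B C A = thetaD A B C := by
  unfold thetaD
  ext E
  simp only [mem_union]
  tauto

/-- Validity is invariant under the cyclic rotation. -/
theorem thetaValid_rotate {A B C : Finset (Finset α)} (h : ThetaValid A B C) :
    ThetaValid B C A := by
  obtain ⟨hA, hB, hC, hAB, hBC, hCA, hAB', hBC', hCA'⟩ := h
  exact ⟨hB, hC, hA, hBC, hCA, hAB, hBC', hCA', hAB'⟩

section Summands

variable {A B C : Finset (Finset α)} {E : Finset α}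

/-- A within-type difference of `A` is a (Θ)-difference. -/
theorem mem_thetaD_of_mem_diffs_left (h : E ∈ A \\ A) : E ∈ thetaD A B C := by
  unfold thetaD; simp only [mem_union]; tauto
/-- A within-type difference of `B` is a (Θ)-difference. -/
theorem mem_thetaD_of_mem_diffs_mid (h : E ∈ B \\ B) : E ∈ thetaD A B C := by
  unfold thetaD; simp only [mem_union]; tauto
/-- A within-type difference of `C` is a (Θ)-difference. -/
theorem mem_thetaD_of_mem_diffs_right (h : E ∈ C \\ C) : E ∈ thetaD A B C := by
  unfold thetaD; simp only [mem_union]; tauto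
/-- An intersection `a ∩ b` is a (Θ)-difference. -/
theorem mem_thetaD_of_mem_infs_AB (h : E ∈ A ⊼ B) : E ∈ thetaD A B C := by
  unfold thetaD; simp only [mem_union]; tauto
/-- An intersection `b ∩ c` is a (Θ)-difference. -/
theorem mem_thetaD_of_mem_infs_BC (h : E ∈ B ⊼ C) : E ∈ thetaD A B C := by
  unfold thetaD; simp only [mem_union]; tauto
/-- An intersection `c ∩ a` is a (Θ)-difference. -/
theorem mem_thetaD_of_mem_infs_CA (h : E ∈ C ⊼ A) : E ∈ thetaD A B C := by
  unfold thetaD; simp only [mem_union]; tauto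
/-- A complement `(a ∪ b)ᶜ` is a (Θ)-difference. -/
theorem mem_thetaD_of_mem_compls_AB (h : E ∈ compls (A ⊻ B)) : E ∈ thetaD A B C := by
  unfold thetaD; simp only [mem_union]; tauto
/-- A complement `(b ∪ c)ᶜ` is a (Θ)-difference. -/
theorem mem_thetaD_of_mem_compls_BC (h : E ∈ compls (B ⊻ C)) : E ∈ thetaD A B C := by
  unfold thetaD; simp only [mem_union]; tauto
/-- A complement `(c ∪ a)ᶜ` is a (Θ)-difference. -/
theorem mem_thetaD_of_mem_compls_CA (h : E ∈ compls (C ⊻ A)) : E ∈ thetaD A B C := by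
  unfold thetaD; simp only [mem_union]; tauto

end Summands

/-- The transversal `F = A ∪ Cᶜ` of an instance. -/
def transversal (A C : Finset (Finset α)) : Finset (Finset α) := A ∪ compls C

/-- Disjointness from the complement family is symmetric. -/
theorem disjoint_compls_comm {A C : Finset (Finset α)} (h : Disjoint C (compls A)) :
    Disjoint A (compls C) := by
  rw [disjoint_left]
  intro t ht htc
  have hc := mem_compls.1 htc
  exact disjoint_left.1 h hc (compl_mem_compls ht)

/-- The transversal has `|A| + |C|` members. -/
theorem card_transversal {A B C : Finset (Finset α)} (h : ThetaValid A B C) :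
    (transversal A C).card = A.card + C.card := by
  unfold transversal
  rw [card_union_of_disjoint (disjoint_compls_comm h.2.2.2.2.2.2.2.2), card_compls]

/-- The differences of the transversal lie in the (Θ)-difference family. -/
theorem diffs_transversal_subset (A B C : Finset (Finset α)) :
    transversal A C \\ transversal A C ⊆ thetaD A B C := by
  intro E hE
  obtain ⟨s, hs, t, ht, rfl⟩ := mem_diffs.1 hE
  unfold transversal at hs ht
  rcases mem_union.1 hs with hsA | hsC <;> rcases mem_union.1 ht with htA | htC
  · exact mem_thetaD_of_mem_diffs_left (mem_diffs.2 ⟨s, hsA, t, htA, rfl⟩)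
  · -- `a \ cᶜ = c ⊓ a`
    have hc := mem_compls.1 htC
    refine mem_thetaD_of_mem_infs_CA (mem_infs.2 ⟨_, hc, s, hsA, ?_⟩)
    rw [inf_eq_inter]
    ext x; simp only [mem_inter, mem_sdiff, mem_univ, true_and]; tauto
  · -- `cᶜ \ a = (c ⊔ a)ᶜ`
    have hc := mem_compls.1 hsC
    refine mem_thetaD_of_mem_compls_CA (mem_compls.2 ?_)
    refine mem_sups.2 ⟨_, hc, t, htA, ?_⟩
    rw [sup_eq_union]
    ext x; simp only [mem_union, mem_sdiff, mem_univ, true_and, not_not, not_and]; tauto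
  · -- `cᶜ \ c'ᶜ = c' \ c`
    have hc := mem_compls.1 hsC
    have hc' := mem_compls.1 htC
    refine mem_thetaD_of_mem_diffs_right (mem_diffs.2 ⟨_, hc', _, hc, ?_⟩)
    ext x; simp only [mem_sdiff, mem_univ, true_and, not_not]; tauto

/-- The required cells of a pair `u ∈ B` at the members of the transversal lie in the
(Θ)-difference family: agreement cells at `A`-members, disagreement cells at `Cᶜ`-members. -/
theorem cells_mem_thetaD {A B C : Finset (Finset α)} {u : Finset α} (hu : u ∈ B) :
    ∀ t ∈ transversal A C,
      (t ∩ u ∈ thetaD A B C ∧ (Finset.univ \ t) ∩ (Finset.univ \ u) ∈ thetaD A B C) ∨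
      (t ∩ (Finset.univ \ u) ∈ thetaD A B C ∧ (Finset.univ \ t) ∩ u ∈ thetaD A B C) := by
  intro t ht
  unfold transversal at ht
  rcases mem_union.1 ht with htA | htC
  · left
    refine ⟨mem_thetaD_of_mem_infs_AB (mem_infs.2 ⟨t, htA, u, hu, inf_eq_inter⟩), ?_⟩
    refine mem_thetaD_of_mem_compls_AB (mem_compls.2 (mem_sups.2 ⟨t, htA, u, hu, ?_⟩))
    rw [sup_eq_union]
    ext x; simp only [mem_union, mem_sdiff, mem_inter, mem_univ, true_and, not_and, not_not]; tauto
  · right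
    have hc := mem_compls.1 htC
    constructor
    · refine mem_thetaD_of_mem_compls_BC (mem_compls.2 (mem_sups.2 ⟨u, hu, _, hc, ?_⟩))
      rw [sup_eq_union]
      ext x; simp only [mem_union, mem_sdiff, mem_inter, mem_univ, true_and, not_and, not_not]; tauto
    · refine mem_thetaD_of_mem_infs_BC (mem_infs.2 ⟨u, hu, _, hc, ?_⟩)
      rw [inf_eq_inter]
      ext x; simp only [mem_inter, mem_sdiff, mem_univ, true_and]; tauto

/-- The signed form of `cells_mem_thetaD`: with the sign pattern «`t ∈ A`», the required cells of
`u ∈ B` at every member of the transversal are (Θ)-differences. -/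
theorem cells_mem_thetaD_signed {A B C : Finset (Finset α)} {u : Finset α} (hu : u ∈ B) :
    ∀ t ∈ transversal A C,
      Cells (thetaD A B C) t (if decide (t ∈ A) = true then u else Finset.univ \ u) := by
  intro t ht
  unfold transversal at ht
  by_cases htA : t ∈ A
  · rw [if_pos (by simpa using htA)]
    refine ⟨mem_thetaD_of_mem_infs_AB (mem_infs.2 ⟨t, htA, u, hu, inf_eq_inter⟩), ?_⟩
    refine mem_thetaD_of_mem_compls_AB (mem_compls.2 (mem_sups.2 ⟨t, htA, u, hu, ?_⟩))
    rw [sup_eq_union]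
    ext x; simp only [mem_union, mem_sdiff, mem_inter, mem_univ, true_and, not_and, not_not]; tauto
  · rw [if_neg (by simpa using htA)]
    have htC : t ∈ compls C := (mem_union.1 ht).resolve_left htA
    have hc := mem_compls.1 htC
    constructor
    · refine mem_thetaD_of_mem_compls_BC (mem_compls.2 (mem_sups.2 ⟨u, hu, _, hc, ?_⟩))
      rw [sup_eq_union]
      ext x; simp only [mem_union, mem_sdiff, mem_inter, mem_univ, true_and, not_and, not_not]; tauto
    · rw [Finset.sdiff_sdiff_eq_self (subset_univ u)]
      refine mem_thetaD_of_mem_infs_BC (mem_infs.2 ⟨u, hu, _, hc, ?_⟩)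
      rw [inf_eq_inter]
      ext x; simp only [mem_inter, mem_sdiff, mem_univ, true_and]; tauto

/-- The (Θ)-difference family is monotone in the middle family. -/
theorem thetaD_mono_mid {A B B' C : Finset (Finset α)} (h : B' ⊆ B) :
    thetaD A B' C ⊆ thetaD A B C := by
  intro E hE
  have h1 : B' \\ B' ⊆ B \\ B := diffs_subset h h
  have h2 : A ⊼ B' ⊆ A ⊼ B := infs_subset_left h
  have h3 : B' ⊼ C ⊆ B ⊼ C := infs_subset_right h
  have h4 : compls (A ⊻ B') ⊆ compls (A ⊻ B) := image_subset_image (sups_subset_left h)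
  have h5 : compls (B' ⊻ C) ⊆ compls (B ⊻ C) := image_subset_image (sups_subset_right h)
  unfold thetaD at hE
  rcases mem_union.1 hE with hE | hE
  · rcases mem_union.1 hE with hE | hE
    · rcases mem_union.1 hE with hE | hE
      · rcases mem_union.1 hE with hE | hE
        · rcases mem_union.1 hE with hE | hE
          · rcases mem_union.1 hE with hE | hE
            · rcases mem_union.1 hE with hE | hE
              · rcases mem_union.1 hE with hE | hE
                · exact mem_thetaD_of_mem_diffs_left hE
                · exact mem_thetaD_of_mem_diffs_mid (h1 hE)
              · exact mem_thetaD_of_mem_diffs_right hE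
            · exact mem_thetaD_of_mem_infs_AB (h2 hE)
          · exact mem_thetaD_of_mem_infs_BC (h3 hE)
        · exact mem_thetaD_of_mem_infs_CA hE
      · exact mem_thetaD_of_mem_compls_AB (h4 hE)
    · exact mem_thetaD_of_mem_compls_BC (h5 hE)
  · exact mem_thetaD_of_mem_compls_CA hE

/-- A sub-instance with a single pair of `B` is valid. -/
theorem thetaValid_singleton {A B C : Finset (Finset α)} (h : ThetaValid A B C) {u : Finset α}
    (hu : u ∈ B) : ThetaValid A {u} C := by
  obtain ⟨hA, hB, hC, hAB, hBC, hCA, hAB', hBC', hCA'⟩ := h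
  have hsub : ({u} : Finset (Finset α)) ⊆ B := singleton_subset_iff.2 hu
  have hsubc : compls {u} ⊆ compls B := image_subset_image hsub
  exact ⟨hA, (hB.mono_left hsub).mono_right hsubc, hC, hAB.mono_right hsub, hBC.mono_left hsub,
    hCA, hAB'.mono_right hsubc, hBC'.mono_left hsub, hCA'⟩

/-- The transversal is disjoint from its complement family. -/
theorem disjoint_transversal_compls {A B C : Finset (Finset α)} (h : ThetaValid A B C) :
    Disjoint (transversal A C) (compls (transversal A C)) := by
  obtain ⟨hA, _, hC, _, _, hCA, _, _, hCA'⟩ := h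
  rw [disjoint_left]
  intro t ht htc
  have htc' := mem_compls.1 htc
  unfold transversal at ht htc'
  rcases mem_union.1 ht with h1 | h1 <;> rcases mem_union.1 htc' with h2 | h2
  · exact disjoint_left.1 hA h1 (mem_compls.2 h2)
  · have h2' := mem_compls.1 h2
    rw [Finset.sdiff_sdiff_eq_self (subset_univ t)] at h2'
    exact disjoint_left.1 hCA h2' h1
  · exact disjoint_left.1 hCA (mem_compls.1 h1) h2
  · exact disjoint_left.1 hC (mem_compls.1 h1) h2

/-- A pair of `B` is not in the transversal, nor is its complement. -/
theorem notMem_transversal {A B C : Finset (Finset α)} (h : ThetaValid A B C) {u : Finset α}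
    (hu : u ∈ B) : u ∉ transversal A C ∧ Finset.univ \ u ∉ transversal A C := by
  obtain ⟨_, _, _, hAB, hBC, _, hAB', hBC', _⟩ := h
  constructor
  · intro hut
    rcases mem_union.1 hut with h1 | h1
    · exact disjoint_left.1 hAB h1 hu
    · exact disjoint_left.1 hBC' hu h1
  · intro hut
    rcases mem_union.1 hut with h1 | h1
    · exact disjoint_left.1 hAB' h1 (compl_mem_compls hu)
    · exact disjoint_left.1 hBC hu (by
        have := mem_compls.1 h1
        rwa [Finset.sdiff_sdiff_eq_self (subset_univ u)] at this)

/-- **The one-pair regime theorem, set form**: (Θ) holds when `B` has at most one member. -/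
theorem theta_card_le_of_card_le_one {A B C : Finset (Finset α)} (h : ThetaValid A B C)
    (hB : B.card ≤ 1) : A.card + B.card + C.card ≤ (thetaD A B C).card := by
  have hF := card_transversal (B := B) h
  have hMS : (transversal A C).card ≤ (transversal A C \\ transversal A C).card :=
    Finset.card_le_card_diffs _
  have hsub := diffs_transversal_subset A B C
  rcases Nat.le_one_iff_eq_zero_or_eq_one.1 hB with h0 | h1
  · rw [h0, add_zero, ← hF]
    exact hMS.trans (card_le_card hsub)
  · obtain ⟨u, hBu⟩ := card_eq_one.1 h1
    have hu : u ∈ B := by rw [hBu]; exact mem_singleton_self u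
    rw [h1]
    by_contra hlt
    have hle : (thetaD A B C).card ≤ (transversal A C).card := by omega
    have heq : transversal A C \\ transversal A C = thetaD A B C :=
      eq_of_subset_of_card_le hsub (hle.trans hMS)
    have htight : Tight (transversal A C) :=
      le_antisymm (by rw [heq]; exact hle) hMS
    have hne : (transversal A C).Nonempty := by
      by_contra hemp
      rw [not_nonempty_iff_eq_empty] at hemp
      have h0 : (∅ : Finset α) ∈ thetaD A B C :=
        mem_thetaD_of_mem_diffs_mid (mem_diffs.2 ⟨u, hu, u, hu, Finset.sdiff_self u⟩)
      have : 1 ≤ (thetaD A B C).card := card_pos.2 ⟨∅, h0⟩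
      rw [hemp, card_empty] at hF
      omega
    have hcond := cells_mem_thetaD (A := A) (C := C) hu
    rw [← heq] at hcond
    obtain ⟨hu1, hu2⟩ := notMem_transversal h hu
    rcases mem_or_compl_mem_of_tight htight hne u hcond with h' | h'
    · exact hu1 h'
    · exact hu2 h'

/-- **(Θ) whenever some type has at most one pair.** -/
theorem theta_card_le_of_some_card_le_one {A B C : Finset (Finset α)} (h : ThetaValid A B C)
    (hsmall : A.card ≤ 1 ∨ B.card ≤ 1 ∨ C.card ≤ 1) :
    A.card + B.card + C.card ≤ (thetaD A B C).card := by
  rcases hsmall with hA | hB | hC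
  · -- rotate twice: `(C, A, B)`
    have := theta_card_le_of_card_le_one (thetaValid_rotate (thetaValid_rotate h)) hA
    rw [thetaD_rotate, thetaD_rotate] at this
    omega
  · exact theta_card_le_of_card_le_one h hB
  · have := theta_card_le_of_card_le_one (thetaValid_rotate h) hC
    rw [thetaD_rotate] at this
    omega

end PercRepro.MSTight
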